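import Summits.RiemannHypothesis.RiemannHypothesis.Theorems.Splittings.ScrewLatticeWolffModel
import Summits.RiemannHypothesis.RiemannHypothesis.Theorems.Splittings.ScrewWolffDiscreteDataC
import Mathlib.Analysis.SpecialFunctions.Complex.Arg
import Mathlib.Analysis.SpecialFunctions.Log.Basic
import HarnessLib

/-!
# B16′ «one-circle Wolff wall»: a blind real-weight configuration whose abscissae are discrete below `σ*`

Cell `rh-split`, lane (xii) SCREW side, gen-15 POSTSCRIPT (census V106/V107 of `cards/SPLIT-screw-bridge.md` §20).
ζ-free and RH-free.

`ScrewLatticeWolffModel.exists_blind_model` (B16) feeds Wolff packing data into the lattice kernel test and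
produces a positive-real-weight configuration of zero quadruples, abscissae in `(0, σ*)` with unattained
supremum, which is BLIND on the lattice `hℕ` (uniform floor, ceiling, `LPSD(h)`).  Its abscissae accumulate at
every level (the data accumulate on every circle of an Apollonian packing), so its aliased wall
`closure {e^{-κ̄ h}} ∩ 𝔻` has infinite length (gen-15 §20: this is why the thin-wall hypothesis `TW(h)` is
consistent with B16).

This file runs the SAME model on the discrete Wolff data of `ScrewWolffDiscreteData.exists_discreteWolffData`
(module `ScrewWolffDiscreteDataC`; «divisor rings»: atoms accumulating only on the outer circle) and records the extra conclusion

  `∀ σ < σ*, {i | Re κ₁ i ≤ σ}` is finite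

— below every abscissa short of `σ*` there are only finitely many zeros.  Consequently the aliased points
`e^{-κ̄ h}` of this blind configuration accumulate only on the circle `‖s‖ = e^{-σ* h}`: the blinding wall is ONE
circle, of finite length `2π e^{-σ* h}` and Hausdorff dimension exactly `1`.  So inside the kernel's class
(real positive weights, `LPSD(h)` + bounded lattice values) the zero-LENGTH threshold of `TW(h)` cannot be
relaxed to «finite length» or to «dimension ≤ 1»: B16′.  Nothing here bears on the truth of RH (for `ζ` the
four functionals have unit weights and the Riemann–von Mangoldt density, which this model does not).

Main theorem: `exists_blind_model_discrete`.
-/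

set_option linter.dupNamespace false

noncomputable section

open Complex Set
open scoped ComplexConjugate Real

namespace Summit.RiemannHypothesis.RiemannHypothesis.Theorems.Splittings.ScrewLatticeWolffOneCircle

open Summit.RiemannHypothesis.RiemannHypothesis.Theorems.Splittings.ScrewLatticeWolff
open Summit.RiemannHypothesis.RiemannHypothesis.Theorems.Splittings.ScrewLatticeWolffModel
open Summit.RiemannHypothesis.RiemannHypothesis.Theorems.Splittings.ScrewWolffDiscreteData

/-- **B16′, kernel form (one-circle Wolff wall).**  For every `h > 0` and `σ* > 0` there is a positive-real-weight
configuration of zero quadruples with abscissae in `(0, σ*)`, ordinates `> 14` and locally finite, `Σ m/γ² < ∞`,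
whose supremum of abscissae is NOT attained, whose model screw function has a uniform positive floor, is bounded,
and is positive semidefinite (`LPSD(h)`) on the lattice `hℕ` — exactly as in B16 (`exists_blind_model`) — and,
in addition, whose abscissae are DISCRETE BELOW `σ*`: for every `σ < σ*` only finitely many `i` have
`Re κ₁ i ≤ σ` (last conjunct).  The aliased wall of this configuration is the single circle `‖s‖ = e^{-σ* h}`. -/
theorem exists_blind_model_discrete {h σs : ℝ} (hh : 0 < h) (hσs : 0 < σs) :
    ∃ (ι : Type) (m₁ m₂ : ι → ℝ) (κ₁ κ₂ : ι → ℂ),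
      Nonempty ι ∧
      (∀ i, 0 < m₁ i ∧ 0 < m₂ i) ∧
      (∀ i, 0 < (κ₁ i).re ∧ (κ₁ i).re < σs ∧ (κ₂ i).re = (κ₁ i).re) ∧
      (∀ i, 14 < (κ₁ i).im ∧ 14 < (κ₂ i).im) ∧
      (∀ T : ℝ, {i | (κ₁ i).im ≤ T}.Finite ∧ {i | (κ₂ i).im ≤ T}.Finite) ∧
      Summable (fun i ↦ m₁ i / (κ₁ i).im ^ 2 + m₂ i / (κ₂ i).im ^ 2) ∧
      (∀ i, ∃ j, (κ₁ i).re < (κ₁ j).re) ∧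
      (∃ A : ℝ, 0 < A ∧ ∀ k : ℕ, 1 ≤ k →
          2 * A ≤ modelPsi m₁ m₂ κ₁ κ₂ (k * h) ∧ modelPsi m₁ m₂ κ₁ κ₂ (k * h) ≤ 6 * A) ∧
      (∀ (N : ℕ) (t x : Fin N → ℝ), (∀ a, t a ∈ Set.range fun k : ℕ ↦ (k : ℝ) * h) →
          0 ≤ ∑ a, ∑ b, (modelPsi m₁ m₂ κ₁ κ₂ (t a) + modelPsi m₁ m₂ κ₁ κ₂ (t b)
            - modelPsi m₁ m₂ κ₁ κ₂ (t a - t b)) * (x a * x b)) ∧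
      (∀ σ < σs, {i | (κ₁ i).re ≤ σ}.Finite) := by
  have hh0 : h ≠ 0 := hh.ne'
  -- discrete Wolff data in the annulus `1 < |w| < e^{σ* h}`
  have hR : 1 < Real.exp (σs * h) := Real.one_lt_exp_iff.mpr (by positivity)
  obtain ⟨ι, hcount, w, α, hne, hann, hα0, hαs, hW, hsup, hdisc⟩ := exists_discreteWolffData hR
  haveI : Countable ι := hcount
  obtain ⟨f, hf⟩ := Countable.exists_injective_nat ι
  -- aliases
  set N₀ : ℕ := ⌈(14 * h + 2 * σs * h + π) / (2 * π)⌉₊ + 1 with hN₀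
  have hN₀ge : (14 * h + 2 * σs * h + π) / (2 * π) + 1 ≤ (N₀ : ℝ) := by
    rw [hN₀]; push_cast; linarith [Nat.le_ceil ((14 * h + 2 * σs * h + π) / (2 * π))]
  set Nf : ι → ℕ := fun i ↦ N₀ + f i with hNf
  -- the data
  set σ : ι → ℝ := fun i ↦ Real.log ‖w i‖ / h with hσ_def
  set γ₁ : ι → ℝ := fun i ↦ (arg (w i) + 2 * π * (Nf i : ℕ)) / h with hγ₁_def
  set γ₂ : ι → ℝ := fun i ↦ (2 * π * (Nf i : ℕ) - arg (w i)) / h with hγ₂_def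
  set κ₁ : ι → ℂ := fun i ↦ ((σ i : ℝ) : ℂ) + ((γ₁ i : ℝ) : ℂ) * I with hκ₁_def
  set κ₂ : ι → ℂ := fun i ↦ ((σ i : ℝ) : ℂ) + ((γ₂ i : ℝ) : ℂ) * I with hκ₂_def
  -- elementary facts
  have hw0 : ∀ i, w i ≠ 0 := fun i ↦ by
    intro h0; have := (hann i).1; rw [h0, norm_zero] at this; linarith
  have hσpos : ∀ i, 0 < σ i := fun i ↦ div_pos (Real.log_pos (hann i).1) hh
  have hσlt : ∀ i, σ i < σs := fun i ↦ by
    rw [hσ_def]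
    simp only
    rw [div_lt_iff₀ hh]
    exact (Real.log_lt_iff_lt_exp (norm_pos_iff.mpr (hw0 i))).mpr (hann i).2
  have hNlow : ∀ i, 14 * h + 2 * σs * h + π ≤ 2 * π * (Nf i : ℕ) - 2 * π := by
    intro i
    have h1 : (N₀ : ℝ) ≤ (Nf i : ℕ) := by rw [hNf]; push_cast; linarith [(f i).cast_nonneg (α := ℝ)]
    have h2 : (14 * h + 2 * σs * h + π) / (2 * π) ≤ (Nf i : ℕ) - 1 := by linarith
    rw [div_le_iff₀ (by positivity)] at h2
    linarith
  have hγ₁low : ∀ i, 14 + 2 * σs < γ₁ i := by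
    intro i
    rw [hγ₁_def]; simp only; rw [lt_div_iff₀ hh]
    linarith [hNlow i, Complex.neg_pi_lt_arg (w i), Real.pi_pos]
  have hγ₂low : ∀ i, 14 + 2 * σs < γ₂ i := by
    intro i
    rw [hγ₂_def]; simp only; rw [lt_div_iff₀ hh]
    linarith [hNlow i, Complex.arg_le_pi (w i), Real.pi_pos]
  -- tuning (λ = 1, c = α i)
  have htun : ∀ i, ∃ m₁ m₂ : ℝ, 0 < m₁ ∧ 0 < m₂ ∧
      (m₁ : ℂ) / ((σ i : ℂ) + γ₁ i * I) ^ 2 + (m₂ : ℂ) / (conj ((σ i : ℂ) + γ₂ i * I)) ^ 2 = -(α i : ℂ) ∧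
      m₁ / γ₁ i ^ 2 ≤ 3 * α i ∧ m₂ / γ₂ i ^ 2 ≤ 3 * α i := fun i ↦
    exists_tuning_bound (hσpos i) (by linarith [hσlt i, hγ₁low i]) (by linarith [hσlt i, hγ₂low i])
      (hα0 i)
  choose m₁ m₂ hm₁ hm₂ htune hb₁ hb₂ using htun
  -- hypotheses of the model theorems
  have hw₁ : ∀ i, Complex.exp (κ₁ i * h) = w i := fun i ↦ exp_kappa₁ (hw0 i) hh0 (Nf i)
  have hw₂ : ∀ i, Complex.exp (κ₂ i * h) = conj (w i) := fun i ↦ exp_kappa₂ (hw0 i) hh0 (Nf i)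
  have htune' : ∀ i, (m₁ i : ℂ) / κ₁ i ^ 2 + (m₂ i : ℂ) / (conj (κ₂ i)) ^ 2
      = -(((1 : ℝ) * α i : ℝ) : ℂ) := by
    intro i; rw [one_mul]; exact htune i
  have hα0' : ∀ i, 0 ≤ α i := fun i ↦ (hα0 i).le
  have hw1 : ∀ i, 1 ≤ ‖w i‖ := fun i ↦ (hann i).1.le
  refine ⟨ι, m₁, m₂, κ₁, κ₂, hne, fun i ↦ ⟨hm₁ i, hm₂ i⟩, ?_, ?_, ?_, ?_, ?_, ?_, ?_, ?_⟩
  · intro i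
    refine ⟨?_, ?_, ?_⟩
    · simpa [hκ₁_def] using hσpos i
    · simpa [hκ₁_def] using hσlt i
    · simp [hκ₁_def, hκ₂_def]
  · intro i
    constructor
    · simpa [hκ₁_def] using (by linarith [hγ₁low i] : 14 < γ₁ i)
    · simpa [hκ₂_def] using (by linarith [hγ₂low i] : 14 < γ₂ i)
  · -- local finiteness: `Im κ ≤ T` forces `f i ≤ ⌊…⌋`, and `f` is injective
    intro T
    have key : ∀ i, (2 * π * (Nf i : ℕ) - π) / h ≤ T → f i ∈ Iic ⌈(T * h + π) / (2 * π)⌉₊ := by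
      intro i hi
      rw [mem_Iic]
      rw [div_le_iff₀ hh] at hi
      have h1 : (f i : ℝ) ≤ (Nf i : ℕ) := by rw [hNf]; push_cast; linarith [(N₀).cast_nonneg (α := ℝ)]
      have h2 : (Nf i : ℝ) ≤ (T * h + π) / (2 * π) := by
        rw [le_div_iff₀ (by positivity)]; linarith
      exact_mod_cast (h1.trans h2).trans (Nat.le_ceil _)
    have hfin : (f ⁻¹' Iic ⌈(T * h + π) / (2 * π)⌉₊).Finite :=
      (finite_Iic _).preimage hf.injOn
    constructor
    · refine hfin.subset fun i hi ↦ key i ?_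
      have hi' : γ₁ i ≤ T := by simpa [hκ₁_def] using hi
      refine le_trans ?_ hi'
      rw [hγ₁_def]; simp only
      exact div_le_div_of_nonneg_right (by linarith [Complex.neg_pi_lt_arg (w i)]) hh.le
    · refine hfin.subset fun i hi ↦ key i ?_
      have hi' : γ₂ i ≤ T := by simpa [hκ₂_def] using hi
      refine le_trans ?_ hi'
      rw [hγ₂_def]; simp only
      exact div_le_div_of_nonneg_right (by linarith [Complex.arg_le_pi (w i)]) hh.le
  · -- Σ m/γ² ≤ 6 Σ α
    have hs6 : Summable (fun i ↦ 6 * α i) := hαs.mul_left 6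
    refine Summable.of_nonneg_of_le (fun i ↦ ?_) (fun i ↦ ?_) hs6
    · have := hm₁ i; have := hm₂ i
      simp only [hκ₁_def, hκ₂_def, Complex.add_im, Complex.ofReal_im, Complex.mul_im, Complex.ofReal_re,
        Complex.I_im, Complex.I_re, mul_one, mul_zero, zero_add, add_zero]
      positivity
    · simp only [hκ₁_def, hκ₂_def, Complex.add_im, Complex.ofReal_im, Complex.mul_im, Complex.ofReal_re,
        Complex.I_im, Complex.I_re, mul_one, mul_zero, zero_add, add_zero]
      linarith [hb₁ i, hb₂ i]
  · -- sup not attained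
    intro i
    obtain ⟨j, hlt⟩ := hsup i
    refine ⟨j, ?_⟩
    simp only [hκ₁_def, Complex.add_re, Complex.ofReal_re, Complex.mul_re, Complex.I_re, Complex.I_im,
      Complex.ofReal_im, mul_zero, mul_one, sub_zero, add_zero, hσ_def]
    exact div_lt_div_of_pos_right (Real.log_lt_log (norm_pos_iff.mpr (hw0 i)) hlt) hh
  · -- floor and ceiling with A = Σ α > 0
    refine ⟨∑' i, α i, ?_, fun k hk ↦ ⟨?_, ?_⟩⟩
    · obtain ⟨i₀⟩ := hne
      exact hαs.tsum_pos hα0' i₀ (hα0 i₀)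
    · have := modelPsi_lattice_floor hw₁ hw₂ htune' hαs hα0' hw1 zero_le_one hW hk
      simpa using this
    · have := modelPsi_lattice_ceiling hw₁ hw₂ htune' hαs hα0' hw1 zero_le_one hW hk
      simpa using this
  · intro N t' x ht'
    exact modelPsi_latticePSD hw₁ hw₂ htune' hαs hα0' hw1 zero_le_one hW t' x ht'
  · -- NEW: discreteness of the abscissae below `σ*` (the data are discrete inside the annulus)
    intro σ' hσ'
    have hρ : Real.exp (σ' * h) < Real.exp (σs * h) := Real.exp_lt_exp.mpr (by nlinarith)
    refine (hdisc (Real.exp (σ' * h)) hρ).subset fun i hi ↦ ?_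
    simp only [Set.mem_setOf_eq] at hi ⊢
    have hi' : Real.log ‖w i‖ / h ≤ σ' := by
      simpa only [hκ₁_def, Complex.add_re, Complex.ofReal_re, Complex.mul_re, Complex.I_re, Complex.I_im,
        Complex.ofReal_im, mul_zero, mul_one, sub_zero, add_zero, hσ_def] using hi
    rw [div_le_iff₀ hh] at hi'
    exact (Real.log_le_iff_le_exp (norm_pos_iff.mpr (hw0 i))).mp hi'

end Summit.RiemannHypothesis.RiemannHypothesis.Theorems.Splittings.ScrewLatticeWolffOneCircle

end
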